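import Summits.AtomisticToContinuum.HydrodynamicLimit.Theses.KickedOrbits
import Literature.MathematicalPhysics.KineticTheory.HardSphereEulerLLN

/-!
# Birth skeleton of the crux `QuenchedToAnnealed` (stmt-AtomisticToContinuum-13145)

Route `route-AtomisticToContinuum-KickedOrbits`, crux decl
`Summit.AtomisticToContinuum.HydrodynamicLimit.Theses.KickedOrbits.QuenchedToAnnealed`
(`QuenchedThermalHydro → <the packing-guarded conjunct with guard ≤ η₁>`: the frame statement "X → Statement"
of the route, an unproved binder of `closes`, crux by role at rank 9, provable-now / L).
Skeleton registrar `planner-skel-stmt-AtomisticToContinuum-13145-0`, 2026-08-17 (BC3 birth certificate of the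
crux; re-audit bin REPAIRABLE). Nothing here restates the crux or the Statement: the two stubs are the two
genuine lemmas of the soft measure-theoretic proof plan recorded in the crux docstring, each stated over
existing Literature declarations only (no Euler equations inside either stub, no `η₁`, no `σ₀`):

* `stub_identifyProfiles` (S1, size M, provable now) — **in-probability limits of the empirical hydrodynamic
  fields are unique and identify continuous profiles.** For ANY family of probability laws `P N` on
  `(N+1)`-particle phase space and any flows, if at one macroscopic time `t` the tested empirical density /
  momentum / energy fields converge in probability (`TendstoHydroFieldsAt`) both to `(ρ, ρu, E)(t)` and to
  `(ρ', ρ'u', E')(t)`, all six profiles continuous and `ρ(t,·) > 0`, then `ρ t = ρ' t`, `u t = u' t`,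
  `θ t = θ' t`. Two deviation events of radius `|a − b|/3` around distinct limits cover phase space, so their
  probabilities cannot both vanish under probability laws; hence `∫ χ ρ(t) = ∫ χ ρ'(t)` for every continuous
  `χ`, and continuous test functions separate continuous profiles on `𝕋³` (Haar measure positive on opens;
  momentum coordinatewise, then `ρ > 0` cancels; energy gives `θ`). USED to identify `u(0,·) = u₀`,
  `θ(0,·) = θ₀` from the crux's `t = 0` hypothesis and the PROVED local-equilibrium law of large numbers
  `localGibbs_lln_holds` — X's fibre law is `velMeasure (u 0) (θ 0) q`, the local Gibbs fibre is
  `velMeasure u₀ θ₀ q` (the "typing slip" named in the crux's why-line is exactly what S1 discharges).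
* `stub_annealedOfQuenched` (S2, THE HEART, size L, provable now) — **quenched-to-annealed transfer for
  measurable events under the local Gibbs measure.** At reduced density `0 < σ ≤ 1/2` (all laws are
  probability measures, `isProbabilityMeasure_localGibbsMeasure` / `…_posGibbsMeasure`), continuous profiles
  `a₀ > 0`, `θ₀ > 0`, `u₀`, a continuous `ρ₀` towards which the empirical DENSITY field satisfies a law of large
  numbers under `localGibbsMeasure`, flows `Φ N` and measurable events `A N`: if along EVERY position sequence
  `q N` whose Maxwellian fibre `(velMeasure u₀ θ₀ (q N)).map zipConfig` is a.e. good and whose empirical density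
  converges to `ρ₀` the fibre probabilities of `A N` tend to `0`, then `localGibbsMeasure σ a₀ u₀ θ₀ N (A N) → 0`.
  Proof plan: the disintegration `lintegral_localGibbsMeasure` (position marginal `posGibbsMeasure`,
  `canonicalPartition_eq_posPartition`, fibres `velMeasure u₀ θ₀ q`); fibres a.e. good for `posGibbs`-a.e. `q`
  (`localGibbsMeasure_absolutelyContinuous` + `HardSphereFlow.measure_compl_good`); a DIAGONAL LEMMA over a
  countable sup-dense family of `C(𝕋³)` turns the in-probability density LLN (`localGibbsMeasure_preimage_pos`)
  into typical position sets `T N` with `posGibbs (T N) → 1` all of whose sequences are density-typical for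
  every continuous `χ`; if `localGibbsMeasure (A N) ↛ 0`, Markov inside `T N ∩ {good fibre}` along a
  subsequence picks ONE full sequence `q` meeting the hypotheses with fibre probability `≥ ε` infinitely often —
  contradiction. This is the reusable quenched→annealed lemma of the route (it will serve
  `QuenchedCollisionFloor`-type transfers verbatim, the events being arbitrary).
* Composition `QuenchedToAnnealed_of : S1 → S2 → QuenchedToAnnealed` (sorry-free; real content: `η₁` from X,
  `σ₀ := min σ_LLN (1/2)` from `localGibbs_lln_holds`, the `t = 0` case is the hypothesis, continuity /
  positivity of the Euler data at `t = 0` from `IsHardSphereEulerSolution`, identification by S1 and `subst`,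
  the time-`0` density LLN moved to the flow-free measure by `localGibbsLaw_preimage_flow_zero`, measurability
  of the three hydrodynamic deviation events at time `t` (`HardSphereFlow.measurable_flow`), and S2 applied to
  each of them with the quenched input supplied by X at `t ∈ (0,T)`), and `QuenchedToAnnealed_skeleton` = the
  crux modulo the two sorries.

Disproof used: none exists for this crux (`Cruxes/QuenchedToAnnealed/` had no workfiles at registration; the
gate was unreachable for `ledger crux ls` at session start, the tree directory was absent). Negatives index
(route header, 2026-08-16): negatives 9168/9236/9238 concern Euler-quantified items without the `∫ρ(0) = 1`
tie / packing guard — S1 and S2 contain no Euler solution at all, S2 no hydrodynamic field; neither is an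
instance of a refuted statement.
-/

noncomputable section

open MeasureTheory Filter Set
open scoped ENNReal Topology BigOperators

namespace Summit.AtomisticToContinuum.HydrodynamicLimit.Cruxes.QuenchedToAnnealed.Birth

open Literature.MathematicalPhysics.KineticTheory Literature.Analysis.FluidPDE
open Summit.AtomisticToContinuum.HydrodynamicLimit.Theses

/-! ## §1 Stub signatures

Each stub's statement is the `Prop` `Sig.stub_<name>`; the registered obligation is
`theorem stub_<name> : Sig.stub_<name> := by sorry` (§2); the composition `QuenchedToAnnealed_of` takes the two
signatures as hypotheses BY NAME (skeleton audit: hypothesis heads = stub names). -/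

/-- **S1 — in-probability limits of the hydrodynamic fields are unique and identify continuous profiles
(size M, provable now).** For probability laws `P N` on `(N+1)`-particle phase space, flows `Φ N`, a time `t`
and two triples of macroscopic fields whose time-`t` slices are continuous, with `ρ(t,·) > 0`: if the empirical
density / momentum / energy fields at time `t` converge in probability both to `(ρ, ρu, E(ρ,u,θ))(t)` and to
`(ρ', ρ'u', E(ρ',u',θ'))(t)`, then the time-`t` profiles coincide. Why true: for `a ≠ b` the events
`{|F − a| > |a−b|/3}` and `{|F − b| > |a−b|/3}` cover phase space, so under probability laws their masses cannot
both tend to `0`; hence `∫ χ ρ(t) = ∫ χ ρ'(t)` (and the momentum / energy analogues) for every continuous `χ`,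
and `χ := ρ(t) − ρ'(t)` gives `∫ (ρ(t) − ρ'(t))² = 0`, so equality everywhere by continuity (Haar measure on
`𝕋³` is positive on open sets); momentum coordinatewise and `ρ(t) > 0` cancels; energy then isolates `θ`.
Leans on: `TendstoHydroFieldsAt`, `empirical{Density,Momentum,Energy}Field`, `totalEnergyDensity`, Mathlib
`Continuous.ae_eq_iff_eq`, `integral_eq_zero_iff_of_nonneg`. -/
def Sig.stub_identifyProfiles : Prop :=
  ∀ {ε : ℕ → ℝ} (P : (N : ℕ) → Measure (Config (N + 1) (Fin 3) T3))
    (Φ : (N : ℕ) → HardSphereFlow (Literature.Analysis.FluidPDE.Torus.geometry (Fin 3)) (ε N) (N + 1)),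
    (∀ N, IsProbabilityMeasure (P N)) →
    ∀ (ρ θ ρ' θ' : ℝ → T3 → ℝ) (u u' : ℝ → T3 → V3) (t : ℝ),
      Continuous (ρ t) → Continuous (u t) → Continuous (θ t) →
      Continuous (ρ' t) → Continuous (u' t) → Continuous (θ' t) →
      (∀ x, 0 < ρ t x) →
      TendstoHydroFieldsAt P Φ ρ u θ t → TendstoHydroFieldsAt P Φ ρ' u' θ' t →
        ρ t = ρ' t ∧ u t = u' t ∧ θ t = θ' t

/-- **S2 — quenched-to-annealed transfer for measurable events under the local Gibbs measure (THE HEART;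
size L, provable now).** At reduced density `0 < σ ≤ 1/2`, for continuous profiles `a₀ > 0`, `θ₀ > 0`, `u₀`, a
continuous `ρ₀` towards which the empirical density field satisfies a law of large numbers under the flow-free
local Gibbs measures `localGibbsMeasure σ a₀ u₀ θ₀ N`, flows `Φ N` and measurable events `A N`: if for EVERY
sequence of position configurations `q N` with `velMeasure u₀ θ₀ (q N)`-a.e. good Maxwellian fibre and
empirical density converging to `ρ₀` the fibre probabilities `((velMeasure u₀ θ₀ (q N)).map zipConfig) (A N)`
tend to `0`, then `localGibbsMeasure σ a₀ u₀ θ₀ N (A N) → 0`. Why true: `localGibbsMeasure` disintegrates over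
its position marginal `posGibbsMeasure` with exactly these fibres (`lintegral_localGibbsMeasure`,
`canonicalPartition_eq_posPartition`); fibres are a.e. good for `posGibbs`-a.e. `q` (absolute continuity w.r.t.
Liouville + `measure_compl_good`); a diagonal lemma over a countable sup-dense family of `C(𝕋³)` upgrades the
in-probability density LLN (`localGibbsMeasure_preimage_pos`) to typical position sets `T N`, `posGibbs (T N) → 1`,
all of whose sequences are density-typical for every continuous `χ`; were `localGibbsMeasure (A N) ↛ 0`, Markov
inside `T N ∩ {good fibre}` along a subsequence would produce ONE admissible sequence `q` with fibre probability
`≥ ε` infinitely often, contradicting the hypothesis. Why it might fail: only through measurability of the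
fibre map `q ↦ velMeasure u₀ θ₀ q (A_q)` (a Gaussian product kernel with continuous parameters — standard) or an
error in the diagonal selection; both are textbook. -/
def Sig.stub_annealedOfQuenched : Prop :=
  ∀ (σ : ℝ), 0 < σ → σ ≤ 1 / 2 →
    ∀ (a₀ θ₀ : T3 → ℝ) (u₀ : T3 → V3), Continuous a₀ → Continuous θ₀ → Continuous u₀ →
      (∀ x, 0 < a₀ x) → (∀ x, 0 < θ₀ x) →
      ∀ (ρ₀ : T3 → ℝ), Continuous ρ₀ →
        (∀ χ : T3 → ℝ, Continuous χ → ∀ δ > (0 : ℝ),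
          Tendsto (fun N : ℕ => localGibbsMeasure σ a₀ u₀ θ₀ N
            {z | δ < |empiricalDensityField z χ - ∫ x, χ x * ρ₀ x|}) atTop (𝓝 0)) →
        ∀ (Φ : (N : ℕ) → HardSphereFlow (Literature.Analysis.FluidPDE.Torus.geometry (Fin 3))
            (hsDiameter σ N) (N + 1))
          (A : (N : ℕ) → Set (Config (N + 1) (Fin 3) T3)), (∀ N, MeasurableSet (A N)) →
          (∀ q : (N : ℕ) → (Fin (N + 1) → T3),
            (∀ N, ∀ᵐ v ∂(velMeasure u₀ θ₀ (q N)), zipConfig (q N, v) ∈ (Φ N).good) →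
            (∀ χ : T3 → ℝ, Continuous χ →
              Tendsto (fun N : ℕ => ((N + 1 : ℕ) : ℝ)⁻¹ * ∑ i, χ (q N i)) atTop
                (𝓝 (∫ x, χ x * ρ₀ x))) →
            Tendsto (fun N : ℕ => ((velMeasure u₀ θ₀ (q N)).map (fun v => zipConfig (q N, v))) (A N))
              atTop (𝓝 0)) →
          Tendsto (fun N : ℕ => localGibbsMeasure σ a₀ u₀ θ₀ N (A N)) atTop (𝓝 0)

/-! ## §2 Stubs (registered; `sorry` only inside them) — hardest: `stub_annealedOfQuenched` -/

/-- **S1 (M, provable now).** Uniqueness of in-probability limits of the empirical fields; continuous test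
functions separate continuous profiles. -/
theorem stub_identifyProfiles : Sig.stub_identifyProfiles := by
  sorry

/-- **S2 (L, provable now; the heart).** Quenched-to-annealed transfer for measurable events under the local
Gibbs measure (disintegration over `posGibbsMeasure` + diagonal typical-set lemma + Markov). -/
theorem stub_annealedOfQuenched : Sig.stub_annealedOfQuenched := by
  sorry

/-! ## §3 Sorry-free helpers of the composition: measurability of the tested empirical fields -/

/-- The tested empirical density field is a measurable function of the configuration. -/
theorem measurable_empiricalDensityField {n : ℕ} {χ : T3 → ℝ} (hχ : Continuous χ) :
    Measurable fun z : Config n (Fin 3) T3 => empiricalDensityField z χ := by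
  have h : (fun z : Config n (Fin 3) T3 => empiricalDensityField z χ) =
      fun z => (n : ℝ)⁻¹ * ∑ i, χ (z i).1 :=
    funext fun z => empiricalDensityField_eq_sum z χ
  rw [h]
  exact measurable_const.mul
    (Finset.measurable_sum _ fun i _ => hχ.measurable.comp (measurable_pi_apply i).fst)

/-- The tested empirical momentum field is a measurable function of the configuration. -/
theorem measurable_empiricalMomentumField {n : ℕ} {χ : T3 → ℝ} (hχ : Continuous χ) :
    Measurable fun z : Config n (Fin 3) T3 => empiricalMomentumField z χ := by
  have h : (fun z : Config n (Fin 3) T3 => empiricalMomentumField z χ) =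
      fun z => (n : ℝ)⁻¹ • ∑ i, χ (z i).1 • (z i).2 :=
    funext fun z => empiricalMomentumField_eq_sum z χ
  rw [h]
  have hs : Measurable fun z : Config n (Fin 3) T3 => ∑ i, χ (z i).1 • (z i).2 :=
    Finset.measurable_sum _ fun i _ =>
      (hχ.measurable.comp (measurable_pi_apply i).fst).smul (measurable_pi_apply i).snd
  exact hs.const_smul ((n : ℝ)⁻¹)

/-- The tested empirical energy field is a measurable function of the configuration. -/
theorem measurable_empiricalEnergyField {n : ℕ} {χ : T3 → ℝ} (hχ : Continuous χ) :
    Measurable fun z : Config n (Fin 3) T3 => empiricalEnergyField z χ := by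
  have h : (fun z : Config n (Fin 3) T3 => empiricalEnergyField z χ) =
      fun z => (n : ℝ)⁻¹ * ∑ i, χ (z i).1 * (‖(z i).2‖ ^ 2 / 2) :=
    funext fun z => empiricalEnergyField_eq_sum z χ
  rw [h]
  refine measurable_const.mul (Finset.measurable_sum _ fun i _ => ?_)
  exact (hχ.measurable.comp (measurable_pi_apply i).fst).mul
    (((measurable_pi_apply i).snd.norm.pow_const 2).div_const 2)

/-! ## §4 Composition (sorry-free) -/

/-- **The line closes the crux modulo its stubs**: `KickedOrbits.QuenchedToAnnealed` BY NAME from S1 and S2.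
Real content: the band `η₁` is X's; the density threshold is `min σ_LLN (1/2)` with `σ_LLN` from the proved
`localGibbs_lln_holds`; the time-`0` conclusion is the hypothesis; for `t ∈ (0, T)` the Euler data at time `0`
are continuous and positive (`IsHardSphereEulerSolution`), S1 identifies `u(0,·) = u₀`, `θ(0,·) = θ₀` against
the local-equilibrium LLN, the time-`0` density LLN is moved to the flow-free measure
(`localGibbsLaw_preimage_flow_zero`), and S2 transfers X's quenched convergence to each of the three (measurable)
hydrodynamic deviation events under `localGibbsLaw = localGibbsMeasure` (`localGibbsLaw_eq`). -/
theorem QuenchedToAnnealed_of (h₁ : Sig.stub_identifyProfiles) (h₂ : Sig.stub_annealedOfQuenched) :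
    KickedOrbits.QuenchedToAnnealed := by
  intro hX
  obtain ⟨η₁, hη₁, HX⟩ := hX
  refine ⟨η₁, hη₁, ?_⟩
  intro a₀ θ₀ u₀ ha hθ hu ha0 hθ0
  obtain ⟨σA, hσA, HA⟩ := localGibbs_lln_holds a₀ θ₀ u₀ ha hθ hu ha0 hθ0
  refine ⟨min σA (1 / 2), lt_min hσA (by norm_num), ?_⟩
  intro σ hσ hσlt T ρ θ u hE hguard Φ h0 t ht
  have hσA' : σ < σA := lt_of_lt_of_le hσlt (min_le_left _ _)
  have hσ2 : σ ≤ 1 / 2 := (lt_of_lt_of_le hσlt (min_le_right _ _)).le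
  rcases eq_or_lt_of_le ht.1 with h0t | htpos
  · -- the time-`0` conclusion is the hypothesis
    subst h0t
    exact h0
  -- `0 < t < T`: the Euler data at time `0`
  have hT : 0 < T := htpos.trans ht.2
  have h0T : (0 : ℝ) ∈ Ico 0 T := ⟨le_rfl, hT⟩
  have hρc : Continuous (ρ 0) := (hE.smooth_density.isSmooth_slice h0T).continuous
  have huc : Continuous (u 0) := (hE.smooth_velocity.isSmooth_slice h0T).continuous
  have hθc : Continuous (θ 0) := (hE.smooth_temperature.isSmooth_slice h0T).continuous
  have hρpos : ∀ x, 0 < ρ 0 x := hE.density_pos 0 h0T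
  have hθpos : ∀ x, 0 < θ 0 x := hE.temperature_pos 0 h0T
  -- identification of the velocity and temperature profiles (S1 against the proved local-equilibrium LLN)
  obtain ⟨ρA, hρAc, -, HΦ⟩ := HA σ hσ hσA'
  obtain ⟨hprob, hllnA⟩ := HΦ Φ
  obtain ⟨-, hu0, hθ0'⟩ := h₁ (fun N => localGibbsLaw σ a₀ u₀ θ₀ N (Φ N)) Φ hprob
    ρ θ (fun _ => ρA) (fun _ => θ₀) u (fun _ => u₀) 0 hρc huc hθc hρAc hu hθ hρpos h0 hllnA
  have hu0' : u 0 = u₀ := hu0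
  have hθ0'' : θ 0 = θ₀ := hθ0'
  subst hu0' hθ0''
  -- the time-`0` density LLN under the flow-free local Gibbs measure, towards `ρ 0`
  have hdens : ∀ χ : T3 → ℝ, Continuous χ → ∀ δ > (0 : ℝ),
      Tendsto (fun N : ℕ => localGibbsMeasure σ a₀ (u 0) (θ 0) N
        {z | δ < |empiricalDensityField z χ - ∫ x, χ x * ρ 0 x|}) atTop (𝓝 0) := by
    intro χ hχ δ hδ
    refine ((h0 χ hχ δ hδ).1).congr fun N => ?_
    exact localGibbsLaw_preimage_flow_zero σ a₀ (u 0) (θ 0) N (Φ N)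
      {z | δ < |empiricalDensityField z χ - ∫ x, χ x * ρ 0 x|}
  have htI : t ∈ Ioo 0 T := ⟨htpos, ht.2⟩
  -- field by field through the annealing lemma (S2), the quenched input being X at `t ∈ (0, T)`
  intro χ hχ δ hδ
  refine ⟨?_, ?_, ?_⟩
  · have hA : ∀ N, MeasurableSet {z : Config (N + 1) (Fin 3) T3 |
        δ < |empiricalDensityField ((Φ N).flow t z) χ - ∫ x, χ x * ρ t x|} := fun N =>
      measurableSet_lt measurable_const
        ((((measurable_empiricalDensityField hχ).comp ((Φ N).measurable_flow t)).sub
          measurable_const).abs)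
    have h := h₂ σ hσ hσ2 a₀ (θ 0) (u 0) ha hθc huc ha0 hθpos (ρ 0) hρc hdens Φ
      (fun N => {z | δ < |empiricalDensityField ((Φ N).flow t z) χ - ∫ x, χ x * ρ t x|}) hA
      (fun q hg hd => (HX σ hσ T ρ θ u hE hguard Φ q hg hd t htI χ hχ δ hδ).1)
    refine h.congr fun N => ?_
    simp only [localGibbsLaw_eq]
  · have hA : ∀ N, MeasurableSet {z : Config (N + 1) (Fin 3) T3 |
        δ < ‖empiricalMomentumField ((Φ N).flow t z) χ - ∫ x, (χ x * ρ t x) • u t x‖} := fun N =>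
      measurableSet_lt measurable_const
        (((measurable_empiricalMomentumField hχ).comp ((Φ N).measurable_flow t)).sub
          measurable_const).norm
    have h := h₂ σ hσ hσ2 a₀ (θ 0) (u 0) ha hθc huc ha0 hθpos (ρ 0) hρc hdens Φ
      (fun N => {z | δ < ‖empiricalMomentumField ((Φ N).flow t z) χ - ∫ x, (χ x * ρ t x) • u t x‖}) hA
      (fun q hg hd => (HX σ hσ T ρ θ u hE hguard Φ q hg hd t htI χ hχ δ hδ).2.1)
    refine h.congr fun N => ?_
    simp only [localGibbsLaw_eq]
  · have hA : ∀ N, MeasurableSet {z : Config (N + 1) (Fin 3) T3 |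
        δ < |empiricalEnergyField ((Φ N).flow t z) χ -
          ∫ x, χ x * totalEnergyDensity (ρ t x) (u t x) (θ t x)|} := fun N =>
      measurableSet_lt measurable_const
        ((((measurable_empiricalEnergyField hχ).comp ((Φ N).measurable_flow t)).sub
          measurable_const).abs)
    have h := h₂ σ hσ hσ2 a₀ (θ 0) (u 0) ha hθc huc ha0 hθpos (ρ 0) hρc hdens Φ
      (fun N => {z | δ < |empiricalEnergyField ((Φ N).flow t z) χ -
        ∫ x, χ x * totalEnergyDensity (ρ t x) (u t x) (θ t x)|}) hA
      (fun q hg hd => (HX σ hσ T ρ θ u hE hguard Φ q hg hd t htI χ hχ δ hδ).2.2)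
    refine h.congr fun N => ?_
    simp only [localGibbsLaw_eq]

/-- The skeleton instantiated: the crux modulo the two registered stubs. -/
theorem QuenchedToAnnealed_skeleton : KickedOrbits.QuenchedToAnnealed :=
  QuenchedToAnnealed_of stub_identifyProfiles stub_annealedOfQuenched

end Summit.AtomisticToContinuum.HydrodynamicLimit.Cruxes.QuenchedToAnnealed.Birth

end
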